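import Summits.CriticalPhenomena.PercolationContinuityZ3.Theorems.Transplant.FKConnectivityAllQClusterDom
import Summits.CriticalPhenomena.PercolationContinuityZ3.Theorems.Transplant.FKConnectivityAllQHubCovFiber
import HarnessLib

/-!
# Connectivity correlation inequalities for `φ_{w,q}`, every `q > 0` — cluster association REDUCED TO COUNTING two-colourings
# fiber by fiber (the combinatorial statement RB), conjecture node and implications

Support file (`--supports stmt-CriticalPhenomena-4575`), FK sub-lane `prim-bschramm-fk-1` (gen 7) of the post-continuity
programme; builds on p205010 (kernel theorem, internal audit signed; external expert review pending).  Definitions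
(`ClusterPairCountOn`, the `@[conjecture]` node `ClusterPairCountAll` — NOT asserted), no named facts, no sorries; standard axioms.

Following fk-1 g6's fiber technique (`…HubCovFiber`): the defect of cluster association `Z·S(C_x ∈ 𝒰 ∩ 𝒱) − S(C_x ∈ 𝒰)·S(C_x ∈ 𝒱)` is
a sum over PAIRS of configurations; the product weight of a pair depends only on its FIBER `(ω₁ ∩ ω₂, ω₁ ∪ ω₂)`
(`weight_mul_weight_eq_fiber`), so the defect is `Σ_fibers c(I,J)·P_{I,J}(q)` with `c ≥ 0` and
`P_{I,J}(q) = Σ_{pairs in the fiber} q^{k(ω₁)+k(ω₂)} (1[C_x(ω₁) ∈ 𝒰 ∩ 𝒱] − 1[C_x(ω₁) ∈ 𝒰]·1[C_x(ω₂) ∈ 𝒱])`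
(`clusterAssoc_defect_eq_fiber_sum`).  Hence the COUNTING CRITERION (`clusterAssocOn_of_count`, every `q > 0`): if in every fiber
and at every level `j = k(ω₁) + k(ω₂)` the pairs with `C_x(ω₁) ∈ 𝒰, C_x(ω₂) ∈ 𝒱` are at most the pairs with `C_x(ω₁) ∈ 𝒰 ∩ 𝒱`, then
`φ(C_x ∈ 𝒰)φ(C_x ∈ 𝒱) ≤ φ(C_x ∈ 𝒰 ∩ 𝒱)`.  Inside a fiber, `ω₁ = I ∪ S` and `ω₂ = I ∪ (D ∖ S)` (`D = J ∖ I`) are the two colour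
classes of a 2-colouring of `D` over the contracted graph; so the criterion is the statement **RB** of the memo: in every finite
multigraph with a marked vertex `x`, at every level of `κ = k(red) + k(blue)`, for all up-sets `U, V`:
`#{R ∈ U, B ∈ V} ≤ #{R ∈ U ∩ V}` (`R`, `B` = red / blue cluster of `x`), i.e. 'given that the red cluster is large, red dominates
blue'.  EVIDENCE (fk-1 g7, exact): 0 violations in 894,264 level tests (multigraphs on `≤ 5` vertices, `≤ 7` edges, all up-set pairs)
and 0 coefficient-negative fibers among 131,696 (random weighted graphs); for `q ≥ 1` the fiberwise VALUE statement is FKG of the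
double model `q^{κ}` but the levelwise count is open for every `q`.  Consequences recorded: `ClusterPairCountAll → ClusterAssocFK q`
(all `q > 0`) `→ HubFKPos` (Ayyer–Linusson–Ravichandran (13)).
[cite: AyyerLinussonRavichandran2025, §7 eq. (13), Conj. 7.1 (p. 22)] [cite: Wagner2006, Conj. 5.3 (p. 13)]
[cite: Grimmett2006, §1.4 eq. (1.20) (p. 15); §3.9 (pp. 63–65)]
-/

noncomputable section

namespace Summit.CriticalPhenomena.PercolationContinuityZ3.Theorems

namespace FK

open MeasureTheory Finset Literature.Probability.LatticeModels Literature.Probability.Percolation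
open scoped Classical

variable {V : Type*} [Fintype V]

open Literature.Probability.Percolation.DecisionTree (ind ind_of_mem ind_of_not_mem ind_nonneg)

/-! ### The association defect as a fiber sum -/

/-- **The cluster-association defect as a fiber sum**: `Z·S(A ∩ B) − S(A)·S(B) = Σ_{(I,J)} c(I,J) Σ_{fiber} q^{k(ω₁)+k(ω₂)}
(1_{A∩B}(ω₁) − 1_A(ω₁)1_B(ω₂))` for any two events `A, B`. [cite: Grimmett2006, §1.4 eq. (1.20) (p. 15)] -/
theorem assoc_defect_eq_fiber_sum (U : Sym2 V → unitInterval) (q : ℝ) (A B : Set (BondConfig V)) :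
    rcPartitionFunctionW U q ∅ * (∑ ω : BondConfig V, rcWeightW U q ∅ ω * ind (A ∩ B) ω) -
        (∑ ω : BondConfig V, rcWeightW U q ∅ ω * ind A ω) * (∑ ω : BondConfig V, rcWeightW U q ∅ ω * ind B ω) =
      ∑ d : BondConfig V × BondConfig V,
        (∏ g : Sym2 V, (if g ∈ d.1 then (U g : ℝ) * (U g : ℝ) else if g ∈ d.2 then (U g : ℝ) * (1 - (U g : ℝ))
          else (1 - (U g : ℝ)) * (1 - (U g : ℝ)))) *
        ∑ pr ∈ (Finset.univ : Finset (BondConfig V × BondConfig V)).filter (fun pr => (pr.1 ∩ pr.2, pr.1 ∪ pr.2) = d),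
          q ^ (clusterCount pr.1 ∅ + clusterCount pr.2 ∅) * (ind (A ∩ B) pr.1 - ind A pr.1 * ind B pr.2) := by
  have hZ : rcPartitionFunctionW U q ∅ = ∑ ω : BondConfig V, rcWeightW U q ∅ ω * (1 : ℝ) := by
    unfold rcPartitionFunctionW; simp
  have e1 := mass_mul_mass_eq_sum U q (fun _ => (1 : ℝ)) (ind (A ∩ B))
  have e2 := mass_mul_mass_eq_sum U q (ind A) (ind B)
  rw [hZ, e1, e2, ← Finset.sum_sub_distrib]
  have lhs : ∑ pr : BondConfig V × BondConfig V,
      (rcWeightW U q ∅ pr.1 * rcWeightW U q ∅ pr.2 * ((1 : ℝ) * ind (A ∩ B) pr.2) -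
        rcWeightW U q ∅ pr.1 * rcWeightW U q ∅ pr.2 * (ind A pr.1 * ind B pr.2)) =
      ∑ pr : BondConfig V × BondConfig V,
        rcWeightW U q ∅ pr.1 * rcWeightW U q ∅ pr.2 * (ind (A ∩ B) pr.1 - ind A pr.1 * ind B pr.2) := by
    -- symmetrise the first summand: `Σ r₁ r₂ 1_{A∩B}(ω₂) = Σ r₁ r₂ 1_{A∩B}(ω₁)`
    have swap : ∑ pr : BondConfig V × BondConfig V, rcWeightW U q ∅ pr.1 * rcWeightW U q ∅ pr.2 * ((1 : ℝ) * ind (A ∩ B) pr.2) =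
        ∑ pr : BondConfig V × BondConfig V, rcWeightW U q ∅ pr.1 * rcWeightW U q ∅ pr.2 * ind (A ∩ B) pr.1 := by
      rw [← Equiv.sum_comp (Equiv.prodComm (BondConfig V) (BondConfig V))]
      refine Finset.sum_congr rfl fun pr _ => ?_
      simp only [Equiv.prodComm_apply, Prod.fst_swap, Prod.snd_swap]; ring
    rw [Finset.sum_sub_distrib, swap, ← Finset.sum_sub_distrib]
    exact Finset.sum_congr rfl fun pr _ => by ring
  rw [lhs]
  rw [← Finset.sum_fiberwise_of_maps_to (s := (Finset.univ : Finset (BondConfig V × BondConfig V)))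
    (t := (Finset.univ : Finset (BondConfig V × BondConfig V))) (g := fun pr => (pr.1 ∩ pr.2, pr.1 ∪ pr.2))
    (fun _ _ => Finset.mem_univ _)]
  refine Finset.sum_congr rfl fun d _ => ?_
  rw [Finset.mul_sum]
  refine Finset.sum_congr rfl fun pr hpr => ?_
  have hd : (pr.1 ∩ pr.2, pr.1 ∪ pr.2) = d := (Finset.mem_filter.1 hpr).2
  subst hd
  rw [rcWeightW_mul_rcWeightW U q pr.1 pr.2]
  ring

/-! ### Levelwise counting gives nonnegativity for every `q ≥ 0` -/

/-- **Levelwise counting criterion**: if at every level `j` of `κ` the "bad" elements are at most the "good" ones, then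
`0 ≤ Σ_{p ∈ S} q^{κ p}(1_good(p) − 1_bad(p))` for every `q ≥ 0`. [folklore] -/
theorem levelPoly_nonneg_of_count {ι : Type*} (S : Finset ι) (κ : ι → ℕ) (isGood isBad : ι → Prop) [DecidablePred isGood]
    [DecidablePred isBad] {q : ℝ} (hq0 : 0 ≤ q)
    (hcount : ∀ j : ℕ, (S.filter fun p => isBad p ∧ κ p = j).card ≤ (S.filter fun p => isGood p ∧ κ p = j).card) :
    0 ≤ ∑ p ∈ S, q ^ κ p * ((if isGood p then (1 : ℝ) else 0) - (if isBad p then (1 : ℝ) else 0)) := by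
  set M := S.sup κ with hM
  have hκM : ∀ p ∈ S, κ p ≤ M := fun p hp => Finset.le_sup hp
  have lev : ∀ (P : ι → Prop) [DecidablePred P], ∑ p ∈ S, q ^ κ p * (if P p then (1 : ℝ) else 0) =
      ∑ j ∈ Finset.range (M + 1), q ^ j * ((S.filter fun p => P p ∧ κ p = j).card : ℝ) := by
    intro P _
    have : ∀ p ∈ S, q ^ κ p * (if P p then (1 : ℝ) else 0) =
        ∑ j ∈ Finset.range (M + 1), (if P p ∧ κ p = j then q ^ j else 0) := by
      intro p hp
      rw [Finset.sum_ite, Finset.sum_const_zero, add_zero]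
      by_cases hP : P p
      · have hfil : (Finset.range (M + 1)).filter (fun j => P p ∧ κ p = j) = {κ p} := by
          ext j
          simp only [Finset.mem_filter, Finset.mem_range, Finset.mem_singleton, hP, true_and]
          constructor
          · rintro ⟨-, h⟩; exact h.symm
          · rintro rfl; exact ⟨Nat.lt_succ_of_le (hκM p hp), rfl⟩
        rw [hfil, Finset.sum_singleton, if_pos hP, mul_one]
      · rw [if_neg hP, mul_zero]
        have hfil : (Finset.range (M + 1)).filter (fun j => P p ∧ κ p = j) = ∅ := by
          ext j; simp [hP]
        rw [hfil, Finset.sum_empty]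
    rw [Finset.sum_congr rfl this, Finset.sum_comm]
    refine Finset.sum_congr rfl fun j _ => ?_
    rw [Finset.card_filter, Nat.cast_sum, Finset.mul_sum]
    refine Finset.sum_congr rfl fun p _ => ?_
    by_cases h : P p ∧ κ p = j
    · rw [if_pos h, if_pos h, Nat.cast_one, mul_one]
    · rw [if_neg h, if_neg h, Nat.cast_zero, mul_zero]
  have split : ∑ p ∈ S, q ^ κ p * ((if isGood p then (1 : ℝ) else 0) - (if isBad p then (1 : ℝ) else 0)) =
      ∑ p ∈ S, q ^ κ p * (if isGood p then (1 : ℝ) else 0) - ∑ p ∈ S, q ^ κ p * (if isBad p then (1 : ℝ) else 0) := by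
    rw [← Finset.sum_sub_distrib]
    exact Finset.sum_congr rfl fun p _ => by ring
  rw [split, lev isGood, lev isBad, ← Finset.sum_sub_distrib]
  refine Finset.sum_nonneg fun j _ => ?_
  rw [← mul_sub]
  refine mul_nonneg (pow_nonneg hq0 _) ?_
  rw [sub_nonneg]
  exact_mod_cast hcount j

/-! ### Cluster association from the counting criterion -/

/-- **The counting criterion for cluster association on the vertex type `V`** (statement RB of the memo, in the original graph's
pairs-of-configurations form): for every vertex `x`, all up-sets `𝒰, 𝒱` of vertex sets, every fiber `(I, J)` and every level `j`,
`#{(ω₁,ω₂) in the fiber : k(ω₁)+k(ω₂) = j, C_x(ω₁) ∈ 𝒰, C_x(ω₂) ∈ 𝒱} ≤ #{… : C_x(ω₁) ∈ 𝒰 ∩ 𝒱}`.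
[cite: Wagner2006, Conj. 5.3 (p. 13)] [cite: AyyerLinussonRavichandran2025, §7 eq. (13) (p. 22)] -/
def ClusterPairCountOn (V : Type*) [Fintype V] : Prop :=
  ∀ (x : V) (𝒰 𝒱 : Set (Set V)), IsUpperSet 𝒰 → IsUpperSet 𝒱 → ∀ (d : BondConfig V × BondConfig V) (j : ℕ),
    (((Finset.univ : Finset (BondConfig V × BondConfig V)).filter (fun pr => (pr.1 ∩ pr.2, pr.1 ∪ pr.2) = d)).filter
        (fun pr => (pr.1 ∈ clusterIn x 𝒰 ∧ pr.2 ∈ clusterIn x 𝒱) ∧ clusterCount pr.1 ∅ + clusterCount pr.2 ∅ = j)).card ≤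
      (((Finset.univ : Finset (BondConfig V × BondConfig V)).filter (fun pr => (pr.1 ∩ pr.2, pr.1 ∪ pr.2) = d)).filter
        (fun pr => pr.1 ∈ clusterIn x 𝒰 ∩ clusterIn x 𝒱 ∧ clusterCount pr.1 ∅ + clusterCount pr.2 ∅ = j)).card

/-- **RB on every finite vertex type `Fin n`.**  CONJECTURE-SHAPED STATEMENT, NOT asserted (a `q`-free counting statement about
2-colourings; evidence in the module docstring). [cite: Wagner2006, Conj. 5.3 (p. 13)]
[cite: AyyerLinussonRavichandran2025, §7 eq. (13), Conj. 7.1 (p. 22)] -/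
@[conjecture] def ClusterPairCountAll : Prop := ∀ n : ℕ, ClusterPairCountOn (Fin n)

/-- **Cluster association from fiber counting** (every `q > 0`): if the counting criterion holds for `(x, 𝒰, 𝒱)` on every fiber
and level, then `φ(C_x ∈ 𝒰)·φ(C_x ∈ 𝒱) ≤ φ(C_x ∈ 𝒰 ∩ 𝒱)` for `φ = φ_{U,q}`, every weight vector `U`.
[cite: Grimmett2006, §1.4 eq. (1.20) (p. 15); §3.9 (p. 63)] -/
theorem clusterAssoc_of_count {q : ℝ} (hq0 : 0 < q) (U : Sym2 V → unitInterval) (x : V) (𝒰 𝒱 : Set (Set V))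
    (hcount : ∀ (d : BondConfig V × BondConfig V) (j : ℕ),
      (((Finset.univ : Finset (BondConfig V × BondConfig V)).filter (fun pr => (pr.1 ∩ pr.2, pr.1 ∪ pr.2) = d)).filter
          (fun pr => (pr.1 ∈ clusterIn x 𝒰 ∧ pr.2 ∈ clusterIn x 𝒱) ∧ clusterCount pr.1 ∅ + clusterCount pr.2 ∅ = j)).card ≤
        (((Finset.univ : Finset (BondConfig V × BondConfig V)).filter (fun pr => (pr.1 ∩ pr.2, pr.1 ∪ pr.2) = d)).filter
          (fun pr => pr.1 ∈ clusterIn x 𝒰 ∩ clusterIn x 𝒱 ∧ clusterCount pr.1 ∅ + clusterCount pr.2 ∅ = j)).card) :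
    (rcMeasureW U q ∅).real (clusterIn x 𝒰) * (rcMeasureW U q ∅).real (clusterIn x 𝒱) ≤
      (rcMeasureW U q ∅).real (clusterIn x 𝒰 ∩ clusterIn x 𝒱) := by
  have hZ := rcPartitionFunctionW_pos U hq0 (∅ : Set V)
  rw [rcMeasureW_real_eq_sum_div U hq0 ∅, rcMeasureW_real_eq_sum_div U hq0 ∅, rcMeasureW_real_eq_sum_div U hq0 ∅,
    div_mul_div_comm, div_le_div_iff₀ (mul_pos hZ hZ) hZ]
  -- it suffices that the defect is `≥ 0`
  suffices hdef : 0 ≤ rcPartitionFunctionW U q ∅ *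
      (∑ ω : BondConfig V, rcWeightW U q ∅ ω * ind (clusterIn x 𝒰 ∩ clusterIn x 𝒱) ω) -
      (∑ ω : BondConfig V, rcWeightW U q ∅ ω * ind (clusterIn x 𝒰) ω) *
        (∑ ω : BondConfig V, rcWeightW U q ∅ ω * ind (clusterIn x 𝒱) ω) by
    nlinarith [hdef, hZ]
  rw [assoc_defect_eq_fiber_sum]
  refine Finset.sum_nonneg fun d _ => mul_nonneg (fiberWeight_nonneg _ (fun g => (U g).2.1) (fun g => (U g).2.2) _ _) ?_
  have key := levelPoly_nonneg_of_count
    ((Finset.univ : Finset (BondConfig V × BondConfig V)).filter (fun pr => (pr.1 ∩ pr.2, pr.1 ∪ pr.2) = d))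
    (fun pr => clusterCount pr.1 ∅ + clusterCount pr.2 ∅)
    (fun pr => pr.1 ∈ clusterIn x 𝒰 ∩ clusterIn x 𝒱)
    (fun pr => pr.1 ∈ clusterIn x 𝒰 ∧ pr.2 ∈ clusterIn x 𝒱) hq0.le (hcount d)
  refine le_trans key (le_of_eq (Finset.sum_congr rfl fun pr _ => ?_))
  congr 1
  have h1 : (if pr.1 ∈ clusterIn x 𝒰 ∩ clusterIn x 𝒱 then (1 : ℝ) else 0) = ind (clusterIn x 𝒰 ∩ clusterIn x 𝒱) pr.1 := by
    by_cases h : pr.1 ∈ clusterIn x 𝒰 ∩ clusterIn x 𝒱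
    · rw [if_pos h, ind_of_mem h]
    · rw [if_neg h, ind_of_not_mem h]
  have h2 : (if pr.1 ∈ clusterIn x 𝒰 ∧ pr.2 ∈ clusterIn x 𝒱 then (1 : ℝ) else 0) =
      ind (clusterIn x 𝒰) pr.1 * ind (clusterIn x 𝒱) pr.2 := by
    by_cases ha : pr.1 ∈ clusterIn x 𝒰
    · by_cases hb : pr.2 ∈ clusterIn x 𝒱
      · rw [if_pos ⟨ha, hb⟩, ind_of_mem ha, ind_of_mem hb, mul_one]
      · rw [if_neg (fun h => hb h.2), ind_of_not_mem hb, mul_zero]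
    · rw [if_neg (fun h => ha h.1), ind_of_not_mem ha, zero_mul]
  rw [h1, h2]

/-- **`ClusterPairCountOn V` ⇒ cluster association on `V` for every `q > 0`.** [cite: AyyerLinussonRavichandran2025, §7 eq. (13) (p. 22)] -/
theorem clusterAssocOn_of_clusterPairCountOn {q : ℝ} (hq0 : 0 < q) (h : ClusterPairCountOn V) : ClusterAssocOn V q :=
  fun U x 𝒰 𝒱 h𝒰 h𝒱 => clusterAssoc_of_count hq0 U x 𝒰 𝒱 (h x 𝒰 𝒱 h𝒰 h𝒱)

/-- **Conjecture nodes: `ClusterPairCountAll → ClusterAssocFKPos`** (and hence `→ HubFKPos`). [cite: AyyerLinussonRavichandran2025, §7 eq. (13), Conj. 7.1 (p. 22)] -/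
theorem clusterAssocFKPos_of_clusterPairCountAll (h : ClusterPairCountAll) : ClusterAssocFKPos :=
  fun _ hq0 n => clusterAssocOn_of_clusterPairCountOn hq0 (h n)

/-- `ClusterPairCountAll → HubFKPos`. [cite: AyyerLinussonRavichandran2025, §7 eq. (13), Conj. 7.1 (p. 22)] -/
theorem hubFKPos_of_clusterPairCountAll (h : ClusterPairCountAll) : HubFKPos :=
  hubFKPos_of_clusterAssocFKPos (clusterAssocFKPos_of_clusterPairCountAll h)

end FK

end Summit.CriticalPhenomena.PercolationContinuityZ3.Theorems

end
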